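import Literature.Analysis.Complex.PlaneDomainUniformizationHolds
import Literature.Analysis.Complex.PlaneDomainDiscCoveringLift
import Mathlib.Analysis.Complex.Schwarz
import HarnessLib

/-!
# Uniformization of plane domains: extremal maps are coverings (N1c as stated)

PROOF-ONLY file (no definitions; abc-iut cell, seat abc-iut-w5-d089 gen 8, follow-up «UNIF-G1P · N1c-AS-STATED»
of abc-iut-L4-t8's programme; GAP row G-L4t8g7-1 is already closed by
`Complex.planeDomainDiscCovering_holds`).  Y. Fisher, J. H. Hubbard, B. S. Wittner, *A proof of the
uniformization theorem for arbitrary plane domains*, Proc. Amer. Math. Soc. **104** (1988) 413–418, Theorem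
p. 413 and Remarks (1)–(2) p. 417 (the universal covering maps are normalised by their derivative at the base
point; «the f_n are unique»): with the tree's theorem that every connected open `U ⊆ ℂ` omitting two
points is holomorphically covered by the disc, the Schwarz lemma gives the classical complement (based
holomorphic disc-lifting through a disc covering, its extremality and its uniqueness up to rotation are
abc-iut-w5-d038's `PlaneDomainDiscCoveringLift.lean`, consumed BY NAME):

* `Complex.exists_rotation_of_norm_deriv_le` — if `π : 𝔻 → U` is a holomorphic covering and
  `F : 𝔻 → U` is holomorphic with `F 0 = π 0` and `‖π′(0)‖ ≤ ‖F′(0)‖`, then `F = π ∘ (c ·)` with `‖c‖ = 1`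
  (the lift of `F` has `‖F̂′(0)‖ = 1`: equality in Schwarz's lemma, Mathlib
  `Complex.affine_of_mapsTo_ball_of_norm_dslope_eq_div`);
* `Complex.exists_isCoveringMap_apply_zero_eq` — re-basing a disc covering by a disc automorphism;
* **`Complex.surjOn_and_isCoveringMap_of_extremal`** — N1c AS STATED: conversely every extremal map of
  that family (any connected open `U` omitting two points, any base point) is onto `U` and a covering map
  — `F = π ∘ (c ·)` for a disc covering `π` of `U` (`Complex.planeDomainDiscCovering_holds`, re-based)
  and a rotation.

Classical mathematics; nothing here touches [IUTchIII] Cor. 3.12.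
[cite: FisherHubbardWittner1988, Theorem p.413, Remarks (1)–(2) p.417] [cite: Conway1978, Ch. VI Thm. 2.5]
-/

noncomputable section

open Set Metric Filter Topology Function

namespace Complex

variable {U : Set ℂ} {π : ℂ → ℂ}

/-! ### 1. Competitors with extremal derivative are rotations of the covering -/

/-- **Lifts of competitors with extremal derivative are rotations.**  If `π : 𝔻 → U` is a holomorphic
covering and `F : 𝔻 → U` is holomorphic with `F 0 = π 0` and `‖π′(0)‖ ≤ ‖F′(0)‖`, then `F = π ∘ (c ·)`
on `𝔻` for some `c` with `‖c‖ = 1` (the lift of `F` has `‖F̂′(0)‖ = 1`; equality case of Schwarz's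
lemma). [cite: FisherHubbardWittner1988, Remark (2) p.417] -/
theorem exists_rotation_of_norm_deriv_le (hπ : DifferentiableOn ℂ π (ball 0 1))
    (hπU : MapsTo π (ball 0 1) U) (hcov : IsCoveringMap hπU.restrict)
    {F : ℂ → ℂ} (hF : DifferentiableOn ℂ F (ball 0 1)) (hFU : MapsTo F (ball 0 1) U)
    (hF0 : F 0 = π 0) (hle : ‖deriv π 0‖ ≤ ‖deriv F 0‖) :
    ∃ c : ℂ, ‖c‖ = 1 ∧ ∀ z ∈ ball (0 : ℂ) 1, F z = π (c * z) := by
  have h0D : (0 : ℂ) ∈ ball (0 : ℂ) 1 := mem_ball_self one_pos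
  obtain ⟨gl, hgld, hglD, hgl0, hglπ⟩ :=
    exists_discLift_of_isCoveringMap hπ hπU hcov hF hFU h0D hF0.symm
  have hmaps : MapsTo gl (ball 0 1) (closedBall (gl 0) 1) := by
    rw [hgl0]
    exact fun t ht => ball_subset_closedBall (hglD ht)
  have hS : ‖deriv gl 0‖ ≤ 1 := norm_deriv_le_one_of_mapsTo_ball hgld hmaps one_pos
  -- `‖F′(0)‖ = ‖π′(0)‖ ‖gl′(0)‖`, hence `‖gl′(0)‖ = 1`
  have hev : F =ᶠ[𝓝 0] (π ∘ gl) := by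
    filter_upwards [isOpen_ball.mem_nhds h0D] with t ht
    exact (hglπ t ht).symm
  have hπd : DifferentiableAt ℂ π 0 := hπ.differentiableAt (isOpen_ball.mem_nhds h0D)
  have hgld0 : DifferentiableAt ℂ gl 0 := hgld.differentiableAt (isOpen_ball.mem_nhds h0D)
  have hFd : deriv F 0 = deriv π 0 * deriv gl 0 := by
    rw [hev.deriv_eq, deriv_comp 0 (by rw [hgl0]; exact hπd) hgld0, hgl0]
  have hπ0 : 0 < ‖deriv π 0‖ := norm_pos_iff.mpr (deriv_ne_zero_of_isCoveringMap_ball hπ hπU hcov h0D)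
  have h1 : ‖deriv gl 0‖ = 1 := by
    refine le_antisymm hS ?_
    rw [hFd, norm_mul] at hle
    exact le_of_mul_le_mul_left (by rw [mul_one]; exact hle) hπ0
  -- equality in Schwarz's lemma: `gl` is the rotation `z ↦ gl′(0) z`
  have haff := affine_of_mapsTo_ball_of_norm_dslope_eq_div (R₂ := 1) hgld hmaps h0D
    (by rw [dslope_same, h1, div_one])
  refine ⟨deriv gl 0, h1, fun z hz => ?_⟩
  have hz' : gl z = deriv gl 0 * z := by
    have := haff hz
    simp only [hgl0, sub_zero, zero_add, smul_eq_mul, dslope_same] at this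
    rw [this, mul_comm]
  rw [← hglπ z hz, hz']

/-! ### 2. N1c as stated: extremal maps are surjective covering maps -/

/-- **Re-basing a disc covering by a disc automorphism.**  If `f : 𝔻 → U` is a holomorphic surjective
covering and `ζ₀ ∈ 𝔻`, then `π = f ∘ φ_{-ζ₀}` is a holomorphic surjective covering with `π 0 = f ζ₀`.
[cite: Conway1978, Ch. VI Prop. 2.2] -/
theorem exists_isCoveringMap_apply_zero_eq {f : ℂ → ℂ} (hf : DifferentiableOn ℂ f (ball 0 1))
    (hfU : MapsTo f (ball 0 1) U) (hsurj : SurjOn f (ball 0 1) U) (hcov : IsCoveringMap hfU.restrict)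
    {ζ₀ : ℂ} (hζ₀ : ζ₀ ∈ ball (0 : ℂ) 1) :
    ∃ (π : ℂ → ℂ) (hπU : MapsTo π (ball 0 1) U), DifferentiableOn ℂ π (ball 0 1) ∧
      SurjOn π (ball 0 1) U ∧ IsCoveringMap hπU.restrict ∧ π 0 = f ζ₀ := by
  have hζ : ‖ζ₀‖ < 1 := mem_ball_zero_iff.mp hζ₀
  have hnζ : ‖-ζ₀‖ < 1 := by rwa [norm_neg]
  -- the disc automorphism `φ_{-ζ₀}` as a homeomorphism of `𝔻`, with inverse `φ_{ζ₀}`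
  let ρ : ball (0 : ℂ) 1 ≃ₜ ball (0 : ℂ) 1 :=
    { toFun := (mapsTo_discMobius hnζ).restrict _ _ _
      invFun := (mapsTo_discMobius hζ).restrict _ _ _
      left_inv := fun z => Subtype.ext (by
        simpa using discMobius_neg_discMobius (a := -ζ₀) hnζ (mem_ball_zero_iff.mp z.2).le)
      right_inv := fun z => Subtype.ext
        (discMobius_neg_discMobius hζ (mem_ball_zero_iff.mp z.2).le)
      continuous_toFun := (differentiableOn_discMobius hnζ).continuousOn.mapsToRestrict _
      continuous_invFun := (differentiableOn_discMobius hζ).continuousOn.mapsToRestrict _ }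
  have hπU : MapsTo (f ∘ discMobius (-ζ₀)) (ball 0 1) U := hfU.comp (mapsTo_discMobius hnζ)
  refine ⟨f ∘ discMobius (-ζ₀), hπU, hf.comp (differentiableOn_discMobius hnζ) (mapsTo_discMobius hnζ),
    ?_, ?_, ?_⟩
  · intro u hu
    obtain ⟨ζ, hζD, rfl⟩ := hsurj hu
    refine ⟨discMobius ζ₀ ζ, mapsTo_discMobius hζ hζD, ?_⟩
    show f (discMobius (-ζ₀) (discMobius ζ₀ ζ)) = f ζ
    rw [discMobius_neg_discMobius hζ (mem_ball_zero_iff.mp hζD).le]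
  · have : hπU.restrict = hfU.restrict ∘ ρ := by
      funext z
      rfl
    rw [this]
    exact hcov.comp_homeomorph ρ
  · show f (discMobius (-ζ₀) 0) = f ζ₀
    rw [discMobius_zero, neg_neg]

/-- **N1c (Fisher–Hubbard–Wittner), as stated: an extremal map is a universal covering.**  Let `U ⊆ ℂ`
be connected, open, omitting two points, and let `F : 𝔻 → U` be holomorphic, maximising `‖f′(0)‖` among
holomorphic `f : 𝔻 → U` with `f 0 = F 0`.  Then `F` maps `𝔻` onto `U` and its restriction `𝔻 → U` is a
covering map: `F = π ∘ (c ·)` for a disc covering `π` (`Complex.planeDomainDiscCovering_holds`) and a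
rotation. [cite: FisherHubbardWittner1988, Theorem p.413] -/
theorem surjOn_and_isCoveringMap_of_extremal (hU : IsOpen U) (hUc : IsConnected U)
    (hab : ∃ a b : ℂ, a ≠ b ∧ a ∉ U ∧ b ∉ U) {F : ℂ → ℂ} (hF : DifferentiableOn ℂ F (ball 0 1))
    (hFU : MapsTo F (ball 0 1) U)
    (hmax : ∀ g : ℂ → ℂ, DifferentiableOn ℂ g (ball 0 1) → MapsTo g (ball 0 1) U → g 0 = F 0 →
      ‖deriv g 0‖ ≤ ‖deriv F 0‖) :
    SurjOn F (ball 0 1) U ∧ IsCoveringMap hFU.restrict := by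
  have h0D : (0 : ℂ) ∈ ball (0 : ℂ) 1 := mem_ball_self one_pos
  obtain ⟨f, hf, hsurj, hfU, hcovf⟩ := planeDomainDiscCovering_holds U hU hUc hab
  obtain ⟨ζ₀, hζ₀, hfζ₀⟩ := hsurj (hFU h0D)
  obtain ⟨π, hπU, hπ, hπsurj, hπcov, hπ0⟩ := exists_isCoveringMap_apply_zero_eq hf hfU hsurj hcovf hζ₀
  have hF0 : F 0 = π 0 := by rw [hπ0, hfζ₀]
  obtain ⟨c, hc, hFc⟩ := exists_rotation_of_norm_deriv_le hπ hπU hπcov hF hFU hF0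
    (hmax π hπ hπU hF0.symm)
  have hc0 : c ≠ 0 := norm_ne_zero_iff.mp (by rw [hc]; exact one_ne_zero)
  have hc' : ‖c⁻¹‖ = 1 := by rw [norm_inv, hc, inv_one]
  -- rotations preserve the disc
  have hrot : ∀ {d : ℂ}, ‖d‖ = 1 → MapsTo (fun z : ℂ => d * z) (ball 0 1) (ball 0 1) :=
    fun hd z hz => by
      rw [mem_ball_zero_iff] at hz ⊢
      rwa [norm_mul, hd, one_mul]
  -- the rotation as a homeomorphism of the disc
  let ρ : ball (0 : ℂ) 1 ≃ₜ ball (0 : ℂ) 1 :=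
    { toFun := (hrot hc).restrict _ _ _
      invFun := (hrot hc').restrict _ _ _
      left_inv := fun z => Subtype.ext (inv_mul_cancel_left₀ hc0 (z : ℂ))
      right_inv := fun z => Subtype.ext (mul_inv_cancel_left₀ hc0 (z : ℂ))
      continuous_toFun := (continuous_const.mul continuous_id).continuousOn.mapsToRestrict _
      continuous_invFun := (continuous_const.mul continuous_id).continuousOn.mapsToRestrict _ }
  refine ⟨fun u hu => ?_, ?_⟩
  · obtain ⟨w, hw, rfl⟩ := hπsurj hu
    refine ⟨c⁻¹ * w, hrot hc' hw, ?_⟩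
    rw [hFc _ (hrot hc' hw), mul_inv_cancel_left₀ hc0]
  · have : hFU.restrict = hπU.restrict ∘ ρ := by
      funext z
      apply Subtype.ext
      exact hFc z z.2
    rw [this]
    exact hπcov.comp_homeomorph ρ

end Complex

end
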